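import Literature.Probability.RandomPlanarGeometry.LatticeSlitIncrements
import HarnessLib

/-!
# Swallowed lattice steps do not move the hull: fills are insensitive to swallowed additions

Companion of `LatticeSlitIncrements.lean` (half-plane Loewner coordinates of a growing lattice
slit: `LatticeSlit.trace / pastSet / pastHull / capTime / drivingValue`). The hull of a lattice
past is the half-plane fill `K_η = Fill_ℍ(S_η)` of the pulled-back polyline attached to `0` by
its stem ([LSW] §2 p. 8, "Fillings": `Fill_ℍ(A)` is the complement of the unbounded component of
`ℍ ∖ A`, closed up). When the polyline crosses its stem it encloses pockets, which the fill
swallows; a later lattice step INSIDE the current hull (inside such a pocket) then changes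
neither the hull nor the capacity time, and its tip — an interior point of the hull — has the
junk driving value `0` (`tipValue` vanishes off `closure (ℍ ∖ K)`). This file PROVES these facts:

* `not_isBounded_unboundedComponent`, `unboundedComponent_diff_union_eq` — the unbounded
  component `V` of `ℍ ∖ S` (`S` bounded) is unbounded, and adding to `S` a set `T` disjoint
  from `V` leaves `V` unchanged (`V` is a connected unbounded subset of `ℍ ∖ (S ∪ T)`, and
  components only shrink when the set shrinks);
* `hpFill_union_eq_of_disjoint`, `hpFill_union_eq_of_subset` — hence
  `Fill_ℍ(S ∪ T) = Fill_ℍ(S)` when `T` misses `V`, in particular when `T ⊆ Fill_ℍ(S)`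
  (`S` closed and bounded);
* `LatticeSlit.trace_subset_pastHull` — the pulled-back polyline lies in its hull;
* `LatticeSlit.pastHull_concat_eq`, `LatticeSlit.capTime_concat_eq` — **a step whose pulled-back
  trace stays in the current hull changes neither the hull nor the capacity time**;
* `LatticeSlit.drivingValue_eq_zero_of_mem_interior` — **a tip in the interior of its hull has
  driving value `0`** (it is off `closure (ℍ ∖ K)`, `tipValue_of_notMem_closure`).

These are the formal content of the remark that the hull family of a lattice path read through
a fixed chordal map with a fixed stem is not generated by a non-crossing curve once the path
enters a swallowed pocket (Lawler (2005), §4.1: the driving function `U_t = g_t(γ(t))` of the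
chain generated by a curve is read at a tip `γ(t) ∈ ∂H_t`).

## References

* G. F. Lawler, O. Schramm, W. Werner, *Conformal restriction: the chordal case*, JAMS 16
  (2003), §2 p. 8 (Fillings). [LawlerSchrammWerner2003Restriction]
* G. F. Lawler, *Conformally Invariant Processes in the Plane*, AMS (2005), §3.4, §4.1.
  [Lawler2005]
-/

noncomputable section

open Set Filter Topology Metric Bornology Complex
open UpperHalfPlane (upperHalfPlaneSet isOpen_upperHalfPlaneSet)
open Literature.Probability.LatticeModels (meshPoint discreteDomainGraph Site)

namespace Literature.Probability.RandomPlanarGeometry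

/-! ### Fills are insensitive to additions off the unbounded component -/

section Fill

variable {S T : Set ℂ}

/-- **The unbounded component of `ℍ ∖ S` is unbounded** (`S` bounded): it contains the vertical
ray above a far point of `ℍ`. [folklore] -/
theorem not_isBounded_unboundedComponent (hSb : IsBounded S) :
    ¬ IsBounded (Loewner.unboundedComponent (upperHalfPlaneSet \ S)) := by
  obtain ⟨R, hR⟩ := hSb.subset_closedBall 0
  obtain ⟨h1, h2⟩ := farPoint_mem R
  intro hb
  set z : ℂ := ((|R| + 1 : ℝ) : ℂ) * I with hz
  refine not_isBounded_upRay z (hb.subset ?_)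
  exact subset_unboundedComponent_of_isPreconnected (isConnected_upRay z).isPreconnected
    (upRay_subset hR h1 h2) (not_isBounded_upRay z)

/-- **Adding a set off the unbounded component does not change it**: if `T` is disjoint from
the unbounded component `V` of `ℍ ∖ S` (`S` bounded), then `V` is also the unbounded component
of `ℍ ∖ (S ∪ T)` — `V` is a connected unbounded subset of the smaller open set, and components of
the smaller set lie in components of the larger one. [cite: LawlerSchrammWerner2003Restriction, §2 p. 8 (Fillings)] -/
theorem unboundedComponent_diff_union_eq (hSb : IsBounded S)
    (hT : Disjoint T (Loewner.unboundedComponent (upperHalfPlaneSet \ S))) :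
    Loewner.unboundedComponent (upperHalfPlaneSet \ (S ∪ T)) =
      Loewner.unboundedComponent (upperHalfPlaneSet \ S) := by
  set V := Loewner.unboundedComponent (upperHalfPlaneSet \ S) with hV
  refine Subset.antisymm ?_ ?_
  · rintro z ⟨hz, hzb⟩
    refine ⟨⟨hz.1, fun h ↦ hz.2 (Or.inl h)⟩, fun hb ↦ hzb (hb.subset ?_)⟩
    exact connectedComponentIn_mono z (sdiff_subset_sdiff_right subset_union_left)
  · have hVsub : V ⊆ upperHalfPlaneSet \ (S ∪ T) := by
      intro w hw
      refine ⟨hw.1.1, ?_⟩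
      rintro (h | h)
      · exact hw.1.2 h
      · exact hT.le_bot ⟨h, hw⟩
    exact subset_unboundedComponent_of_isPreconnected
      (isConnected_unboundedComponent hSb).isPreconnected hVsub
      (not_isBounded_unboundedComponent hSb)

/-- **`Fill_ℍ(S ∪ T) = Fill_ℍ(S)` when `T` misses the unbounded component of `ℍ ∖ S`**
(`S` bounded). [cite: LawlerSchrammWerner2003Restriction, §2 p. 8 (Fillings)] -/
theorem hpFill_union_eq_of_disjoint (hSb : IsBounded S)
    (hT : Disjoint T (Loewner.unboundedComponent (upperHalfPlaneSet \ S))) :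
    hpFill (S ∪ T) = hpFill S := by
  rw [hpFill, hpFill, unboundedComponent_diff_union_eq hSb hT]

/-- The fill misses the unbounded component (`S` closed and bounded; `ℍ ∖ Fill_ℍ(S)` is that
component, `diff_hpFill`). [folklore] -/
theorem disjoint_hpFill_unboundedComponent (hS : IsClosed S) (hSb : IsBounded S) :
    Disjoint (hpFill S) (Loewner.unboundedComponent (upperHalfPlaneSet \ S)) := by
  rw [← diff_hpFill hS hSb]
  exact disjoint_sdiff_right

/-- **`Fill_ℍ(S ∪ T) = Fill_ℍ(S)` when `T ⊆ Fill_ℍ(S)`** (`S` closed and bounded): swallowed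
additions do not change the fill. [cite: LawlerSchrammWerner2003Restriction, §2 p. 8 (Fillings)] -/
theorem hpFill_union_eq_of_subset (hS : IsClosed S) (hSb : IsBounded S) (hT : T ⊆ hpFill S) :
    hpFill (S ∪ T) = hpFill S :=
  hpFill_union_eq_of_disjoint hSb ((disjoint_hpFill_unboundedComponent hS hSb).mono_left hT)

/-- The interior of the fill misses the closure of the unbounded component (an open set disjoint
from `V` is disjoint from `closure V`). [folklore] -/
theorem disjoint_interior_hpFill_closure (hS : IsClosed S) (hSb : IsBounded S) :
    Disjoint (interior (hpFill S)) (closure (Loewner.unboundedComponent (upperHalfPlaneSet \ S))) :=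
  ((disjoint_hpFill_unboundedComponent hS hSb).mono_left interior_subset).closure_right
    isOpen_interior

end Fill

/-! ### Lattice steps inside the current hull -/

namespace LatticeSlit

variable {D : DobrushinDomain} {φ : ConformalEquiv upperHalfPlaneSet D.carrier} {δ : ℝ}
  {a w : Site 2}

/-- The pulled-back trace lies in `ℍ` (`φ⁻¹` maps `D` into `ℍ`; only polyline points of `D` are
pulled back). [folklore] -/
theorem trace_subset_upperHalfPlaneSet (η : (discreteDomainGraph D.carrier δ).Walk a w) :
    trace φ η ⊆ upperHalfPlaneSet := by
  rintro _ ⟨p, ⟨-, hp⟩, rfl⟩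
  exact φ.symm_mapsTo hp

/-- **The pulled-back trace lies in its hull** (`S ∩ ℍ ⊆ Fill_ℍ(S)`). [folklore] -/
theorem trace_subset_pastHull (η : (discreteDomainGraph D.carrier δ).Walk a w) :
    trace φ η ⊆ pastHull φ η := fun _ hz ↦
  inter_subset_hpFill _ ⟨subset_closure (Or.inr hz), trace_subset_upperHalfPlaneSet η hz⟩

/-- **A step inside the hull does not change the hull**: if the pulled-back trace of the
extended walk `η·u` stays in `K_η` (the new segment lies in the current hull — e.g. a step
inside a swallowed pocket), then `K_{η·u} = K_η` (`η` a walk whose polyline stays in `D`, so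
that `S_η` is closed and bounded). [cite: LawlerSchrammWerner2003Restriction, §2 p. 8 (Fillings)] -/
theorem pastHull_concat_eq (η : (discreteDomainGraph D.carrier δ).Walk a w) {u : Site 2}
    (h : (discreteDomainGraph D.carrier δ).Adj w u)
    (hη : range (η.toCurve (meshPoint δ)) ⊆ D.carrier)
    (hnew : trace φ (η.concat h) ⊆ pastHull φ η) :
    pastHull φ (η.concat h) = pastHull φ η := by
  obtain ⟨hSc, hSb, -⟩ := pastSet_attached (φ := φ) η hη
  -- `S_{η·u} = S_η ∪ closure (trace (η·u))`, and the added part lies in the closed set `K_η`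
  have hT : closure (trace φ (η.concat h)) ⊆ pastHull φ η :=
    closure_minimal hnew (isClosed_hpFill _)
  have hS' : pastSet φ (η.concat h) = pastSet φ η ∪ closure (trace φ (η.concat h)) := by
    rw [pastSet, pastSet, closure_union, closure_union, union_assoc,
      union_eq_right.2 (closure_mono (trace_subset_trace_concat η h))]
  rw [pastHull, hS', hpFill_union_eq_of_subset hSc hSb hT, ← pastHull]

/-- **Nor the capacity time**: `t_{η·u} = t_η` for a step inside the hull. [cite: Lawler2005, §4.1 Remark 4.5 with §3.4 Def. 3.37] -/
theorem capTime_concat_eq (η : (discreteDomainGraph D.carrier δ).Walk a w) {u : Site 2}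
    (h : (discreteDomainGraph D.carrier δ).Adj w u)
    (hη : range (η.toCurve (meshPoint δ)) ⊆ D.carrier)
    (hnew : trace φ (η.concat h) ⊆ pastHull φ η) :
    capTime φ (η.concat h) = capTime φ η := by
  rw [capTime, capTime, pastHull_concat_eq η h hη hnew]

/-- `ℍ ∖ K_η` is the unbounded component of `ℍ ∖ S_η` (walk inside `D`). [folklore] -/
theorem diff_pastHull_eq (η : (discreteDomainGraph D.carrier δ).Walk a w)
    (hη : range (η.toCurve (meshPoint δ)) ⊆ D.carrier) :
    upperHalfPlaneSet \ pastHull φ η = Loewner.unboundedComponent (upperHalfPlaneSet \ pastSet φ η) := by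
  obtain ⟨hSc, hSb, -⟩ := pastSet_attached (φ := φ) η hη
  exact diff_hpFill hSc hSb

/-- **A swallowed tip has driving value `0`**: if the tip `φ⁻¹(δ w)` of a walk inside `D` lies
in the interior of its hull `K_η`, it is off `closure (ℍ ∖ K_η)` and `ξ_η = tipValue K_η (tip)`
is the junk value `0` (`tipValue_of_notMem_closure`). [cite: Lawler2005, §4.1 Lemma 4.2] -/
theorem drivingValue_eq_zero_of_mem_interior (η : (discreteDomainGraph D.carrier δ).Walk a w)
    (hη : range (η.toCurve (meshPoint δ)) ⊆ D.carrier)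
    (htip : tipPt φ η ∈ interior (pastHull φ η)) : drivingValue φ η = 0 := by
  obtain ⟨hSc, hSb, -⟩ := pastSet_attached (φ := φ) η hη
  refine tipValue_of_notMem_closure fun hmem ↦ ?_
  rw [diff_pastHull_eq η hη] at hmem
  exact (disjoint_interior_hpFill_closure hSc hSb).le_bot ⟨htip, hmem⟩

/-- The same for the extended walk `η·u` read against the unchanged hull: if the new trace stays
in `K_η` and the new tip `φ⁻¹(δ u)` is an interior point of `K_η`, then `t_{η·u} = t_η` while
`ξ_{η·u} = 0`. [cite: Lawler2005, §4.1 Lemma 4.2] -/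
theorem capTime_concat_eq_and_drivingValue_eq_zero (η : (discreteDomainGraph D.carrier δ).Walk a w)
    {u : Site 2} (h : (discreteDomainGraph D.carrier δ).Adj w u)
    (hη' : range ((η.concat h).toCurve (meshPoint δ)) ⊆ D.carrier)
    (hnew : trace φ (η.concat h) ⊆ pastHull φ η)
    (htip : tipPt φ (η.concat h) ∈ interior (pastHull φ η)) :
    capTime φ (η.concat h) = capTime φ η ∧ drivingValue φ (η.concat h) = 0 := by
  have hη : range (η.toCurve (meshPoint δ)) ⊆ D.carrier :=
    (range_toCurve_subset_concat _ η h).trans hη'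
  refine ⟨capTime_concat_eq η h hη hnew, drivingValue_eq_zero_of_mem_interior _ hη' ?_⟩
  rwa [pastHull_concat_eq η h hη hnew]

end LatticeSlit

end Literature.Probability.RandomPlanarGeometry

end
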